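import Summits.QuantumFields.YangMills.Theorems.BalabanUVNodesN11NoExpansionTStepOfCoerciveOnJointSupport

/-!
# DAG node N11 — THE NODE FACES FROM THE JOINT-SUPPORT COERCIVE ROW LISTS: one level of (S1ᵀ), the (S1ᵀ) slot (`h11`'s row shape), `densitiesDescribed`, the
# DAG node `Dag.B14_main (leavesP w p)` at a world bound to the CoPH datum of a GENERIC `θ`, and [III] Thm 1 at that datum — from node00-def-K0b's VALUE rows with
# COERCIVITY OF `quad` ASKED ONLY ON THE JOINT SUPPORT OF THE INTEGRAND's CERTIFICATES, node00-def-T's six term rows and the §3 supplier's `Sect3SpliceSupplyAt`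

HEADER — WORK-UNIT METADATA.  Cell `pub-ymgap`, YM-PLAN Track A (HUMAN RULING D-0062 ∕ D-0149), WIDTH SEAT `pub-ymgap-dag-n11-w4` (g2) on NODE n11 [B14]; route
`BalabanUVNodes` rev 25, item K1⁷ `StabilityBAtRecordR13SepCoPH` = stmt-QuantumFields-20542 (helper, `--kind proof --supports 20542 --as helper`, count-neutral).
The joint-support twin of this base's g0 `…N11NodeFacesOfCoercive` (p590141): dag-n11-e's p578897 faces `tLaw₁₃CoPH_of_sLaw₁₃CoPH_of_tStep_of_supply` ∕
`densitiesDescribed_of_tStep_of_supply_of_liveSel` ∕ `b14_main_of_tStep_of_supply_of_liveSel` ∕ `thm1Printed_datumOfRecord₁₃CoPH_of_tStep_of_supply_of_liveSel` with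
`hT` (`NoExpansionTStepAt`) supplied by this seat's `noExpansionTStepAt_of_jointCoercive_termRows_at_present_parents` and `hsup` (`Sect3SupplyAt`) by dag-n11-e's p586169
`sect3SupplyAt_of_spliceSupply`.  Proofs = g0's VERBATIM with the coercivity conjunct re-typed.  [III] = [Balaban1988Convergent], [IV] = [Balaban1989LargeFieldI],
[I] = [Balaban1987RG1].

WHAT THIS FILE PROVES (0 `sorry`, 0 `def`).  §1 ★ `tLaw₁₃CoPH_of_sLaw₁₃CoPH_of_jointCoercive_termRows_of_spliceSupply` (ONE level of (S1ᵀ) at a generic `θ`) · ★★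
`thmP245Laws_of_jointCoercive_termRows_of_spliceSupply` (the (S1ᵀ) slot `∀ k < K, SLaw_k → TLaw_k` — the ROW SHAPE `h11` of the K1⁷ four-pin engine).  §2 ★★
`densitiesDescribed_of_jointCoercive_termRows_of_spliceSupply_of_liveSel` · ★★★ `b14_main_of_jointCoercive_termRows_of_spliceSupply_of_liveSel` · ★★★
`thm1Printed_datumOfRecord₁₃CoPH_of_jointCoercive_termRows_of_spliceSupply_of_liveSel`.  Hypotheses throughout: core provisos, `ZhUnity`, `1 ≤ M`, `0 ≤ E₀, B₀` (+ selector
clause, admissibility, `0 ≤ κ` on the live line); per level `k < K`, for every `k`-local exposed witness at every no-expansion history with a PRESENT parent: the pins (P), (V),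
`quad_k(∅) = 0`, `k`-locality; measurability of `ζ0 ∕ quad`; JOINT-SUPPORT COERCIVITY of `quad_j(Λ_{j+1})` ([I]'s positivity of `𝒬_j` exactly where `χ_k(init s′)(U₀) ≠ 0`
and every `ζ0_i((Ω_{i+1})ᶜ)`, `j ≤ i < k`, is alive at an `A_i`-fibre-mate — fed, per history, from def-T's `RegOn Γr` + positivity at reading-regular backgrounds of
every scale present); def-T's six term rows; and `Sect3SpliceSupplyAt θ p k`.

HONEST FRAMING.  Helper lane of K1⁷; count-neutral kernel composition of accepted theorems; rows + supply DISPLAYED, nothing of Bałaban asserted; N11 NOT discharged; K1⁷ NOT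
closed; counts unmoved (typed 28∕28 · discharged 5∕27).  One finite four-torus programme at fixed `ε = L^{−K}`; R4 closes only the conditional finite-𝕋⁴ rung `BalabanLadder.UV`
— NOT ℝ⁴, NOT OS, NOT a mass gap, NOT Clay.  No `sorry`, `axiom`, `def`, `instance`, `notation`.
Sources (SHAPE only): [III] Theorem p.245, Thm 1 p.262, Thm 2 p.263, p.244, (2.10) p.256, (2.17) p.257, §2 p.262, (3.24)–(3.25) p.270, §3 p.279, (3.67) p.283; [IV]
(0.2)–(0.4) p.176, p.177 (i)–(ii); [I] (2.11) p.267 (shape of the row).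
-/
noncomputable section

open MeasureTheory
open scoped BigOperators ENNReal NNReal Matrix.Norms.L2Operator

namespace Summit.QuantumFields.YangMills.Theorems.BalabanUVNodesN11NodeFacesOfCoerciveOnJointSupport

open Literature.MathematicalPhysics.QuantumFieldTheory.Balaban1983to89 T4Continuum T4AdjointCovariance Node00 Node00.Tk DagBinding
open B15DeterminingSets (MSField)
open B10Eq42TorusConstraint (bondsIn)
open BalabanUVNodesN11FluctTruncationDefs (IsFluctLocal)
open BalabanUVNodesN11Sect3SupplyDefs (NoExpansionTStepAt Sect3SupplyAt)
open BalabanUVNodesN11Sect3SupplySpliceDefs (Sect3SpliceSupplyAt)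
open BalabanUVNodesN11Sect3SupplySplice (sect3SupplyAt_of_spliceSupply)
open BalabanUVNodesN11ThmP245OfSect3SupplyCoPH (tLaw₁₃CoPH_of_sLaw₁₃CoPH_of_tStep_of_supply densitiesDescribed_of_tStep_of_supply_of_liveSel
  b14_main_of_tStep_of_supply_of_liveSel thm1Printed_datumOfRecord₁₃CoPH_of_tStep_of_supply_of_liveSel)
open BalabanUVNodesN11NoExpansionTStepOfCoerciveOnJointSupport (noExpansionTStepAt_of_jointCoercive_termRows_at_present_parents)

variable {F : T4Family} {N : ℕ} [NeZero N]
variable (θ : Stage13HParams F N) (p : B12.RunParams)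

/-! ## §1  One level of (S1ᵀ) and the (S1ᵀ) slot from the joint-support coercive term-row list and the splice supply -/

/-- **★ ONE LEVEL OF (S1ᵀ) AT A GENERIC `θ` FROM THE JOINT-SUPPORT COERCIVE TERM-ROW LIST AND THE SPLICE SUPPLY**: `SLaw₁₃CoPH θ p k → TLaw₁₃CoPH θ p k` from (core provisos, `ZhUnity`,
`k < K`, `1 ≤ M`, `0 ≤ E₀, B₀`) the coercive term-row list at level `k` (p588421's grammar: per `k`-local exposed witness at every no-expansion history with a present parent —
pins, measurability, JOINT-SUPPORT COERCIVITY of `quad`, def-T's six term rows) and `Sect3SpliceSupplyAt θ p k` — dag-n11-e's `tLaw₁₃CoPH_of_sLaw₁₃CoPH_of_tStep_of_supply` fed by p588421 and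
p586169. [cite: Balaban1988Convergent, Theorem p.245, Thm 1 p.262, §2 p.262, (3.24)–(3.25) p.270, p.279; Balaban1987RG1, (2.11) p.267 (shape)] -/
theorem tLaw₁₃CoPH_of_sLaw₁₃CoPH_of_jointCoercive_termRows_of_spliceSupply (h : θ.Provisos₁₃CoPH F N) (hU : θ.ZhUnity F N) {k : ℕ} (hk : k < p.K)
    (hM : 1 ≤ θ.τ9.M) (hB₀ : 0 ≤ θ.s2.lf.B₀) (hE₀ : 0 ≤ θ.s2.lf.E₀)
    (hrows : ∀ (t : SeqOfRecord F θ.ν θ.τ9.M (gOfRecord₁₃ F N θ.toStage13Params p) p.K k → Sect2.TermValues (F.P p.K) (MatA N) (FluctV N) θ.τ9.M)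
        (Ek : SeqOfRecord F θ.ν θ.τ9.M (gOfRecord₁₃ F N θ.toStage13Params p) p.K k → ℝ),
        HasSect2FormAtZS F N (FluctV N) p.K (settingOfRecord₁₃ F N θ.toStage13Params p) k (θ.rzAt p) (WtOfRecord₁₃H F N θ p)
          (UbgOfRecord₁₃CoP F N θ.toStage13Params p k)
          (fun s u => Sect2.LawsRT (sect2TowerOfRecord F N (FluctV N) p.K (settingOfRecord₁₃ F N θ.toStage13Params p) (θ.rzAt p s) s u)
            (settingOfRecord₁₃ F N θ.toStage13Params p).lf k)
          (slotsOfRecord F N θ.ν θ.τ9 (EOfRecord₁₃ F N θ.toStage13Params) (wOfRecord₉ F N θ.toStage9Params) θ.ppSel p (gOfRecord₁₃ F N θ.toStage13Params p) k) t Ek →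
        (∀ s₀, IsFluctLocal k (t s₀)) →
        ∀ s : SeqOfRecord F θ.ν θ.τ9.M (gOfRecord₁₃ F N θ.toStage13Params p) p.K (k + 1), s.Ω (k + 1) = ∅ →
          slotsOfRecord F N θ.ν θ.τ9 (EOfRecord₁₃ F N θ.toStage13Params) (wOfRecord₉ F N θ.toStage9Params) θ.ppSel p (gOfRecord₁₃ F N θ.toStage13Params p) k s.init ≠ 0 →
          (∀ j, j < k → (θ.zhAt p s).ζ0 j = (θ.zhAt p s.init).ζ0 j ∧ (θ.zhAt p s).quad j = (θ.zhAt p s.init).quad j) ∧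
          (∀ (V' : GaugeField (F.P p.K) (k + 1) (SU N)) (U₀ : GaugeField (F.P p.K) k (SU N)),
            (θ.zhAt p s).ζ0 k Set.univ (pairCfgAt (V := FluctV N) k V' U₀) =
              chiSeqOfRecord F N θ.ν θ.τ9.M (gOfRecord₁₃ F N θ.toStage13Params p) p.K k s.init U₀ *
                wOfRecord₉ F N θ.toStage9Params p (gOfRecord₁₃ F N θ.toStage13Params p) k s U₀ ((avOfRecord F N p.K k).avg U₀)) ∧
          (∀ (V' : GaugeField (F.P p.K) (k + 1) (SU N)) (U₀ : GaugeField (F.P p.K) k (SU N)), (θ.zhAt p s).quad k ∅ (pairCfgAt (V := FluctV N) k V' U₀) = 0) ∧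
          (∀ j, j < k → ∀ ω ω' : MultiCfg (F.P p.K) (SU N) (FluctV N), (∀ i, i ≤ k → ω i = ω' i) →
            (θ.zhAt p s).quad j (s.init.Λ (j + 1)) ω = (θ.zhAt p s).quad j (s.init.Λ (j + 1)) ω') ∧
          (∀ j (Y : Set (Site (F.P p.K) 0)), Measurable ((θ.zhAt p s).ζ0 j Y)) ∧
          (∀ j (Λ' : Set (Site (F.P p.K) 0)), Measurable ((θ.zhAt p s).quad j Λ')) ∧
          (∀ j : ℕ, j < k → ∃ c : ℝ, 0 < c ∧ ∀ ω' : MultiCfg (F.P p.K) (SU N) (FluctV N),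
            chiSeqOfRecord F N θ.ν θ.τ9.M (gOfRecord₁₃ F N θ.toStage13Params p) p.K k s.init (ω' k).1 ≠ 0 →
            (∀ i, j ≤ i → i < k → ∃ cf : JCfg (F.P p.K) i (SU N) (FluctV N), cf.1 = (ω' i).1 ∧
              (∀ b, b ∉ bondsIn i ((s.init.Λ (i + 1))ᶜ ∩ s.init.Ω (i + 1)) → cf.2 b = (ω' i).2 b) ∧
              (θ.zhAt p s).ζ0 i (s.init.Ω (i + 1))ᶜ (Function.update ω' i cf) ≠ 0) →
            c * ∑ b ∈ (Set.toFinite (bondsIn j ((s.init.Λ (j + 1))ᶜ ∩ s.init.Ω (j + 1)))).toFinset, ‖(ω' j).2 b‖ ^ 2 ≤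
              (θ.zhAt p s).quad j (s.init.Λ (j + 1)) ω') ∧
          (∀ (j : ℕ) (X : (Sect2.domSys (F.P p.K) θ.τ9.M j).Dom) (z : Site (F.P p.K) j) (g' : ℝ),
            Measurable (fun U : GaugeField (F.P p.K) 0 (SU N) => ((t s.init).E j X z g' (Sect2.ofBackgroundC (settingOfRecord₁₃ F N θ.toStage13Params p).ι U)).re)) ∧
          (∀ (j : ℕ) (X : (Sect2.domSys (F.P p.K) θ.τ9.M j).Dom),
            Measurable (fun U : GaugeField (F.P p.K) 0 (SU N) => ((t s.init).R j X (Sect2.ofBackgroundC (settingOfRecord₁₃ F N θ.toStage13Params p).ι U)).re)) ∧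
          (∀ (S' : ℕ → Set (Site (F.P p.K) 0)) (j : ℕ) (X : (Sect2.domSys (F.P p.K) θ.τ9.M j).Dom),
            Measurable (fun q : GaugeField (F.P p.K) 0 (SU N) × MSFluct (F.P p.K) (FluctV N) =>
              ((t s.init).B j X (Sect2.ofBackgroundC (settingOfRecord₁₃ F N θ.toStage13Params p).ι q.1) (S', q.2)).re)) ∧
          (∃ CE : ℝ, ∀ (j : ℕ) (X : (Sect2.domSys (F.P p.K) θ.τ9.M j).Dom) (z : Site (F.P p.K) j) (g' : ℝ) (U : GaugeField (F.P p.K) 0 (SU N)),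
            |((t s.init).E j X z g' (Sect2.ofBackgroundC (settingOfRecord₁₃ F N θ.toStage13Params p).ι U)).re| ≤ CE) ∧
          (∃ CR : ℝ, ∀ (j : ℕ) (X : (Sect2.domSys (F.P p.K) θ.τ9.M j).Dom) (U : GaugeField (F.P p.K) 0 (SU N)),
            |((t s.init).R j X (Sect2.ofBackgroundC (settingOfRecord₁₃ F N θ.toStage13Params p).ι U)).re| ≤ CR) ∧
          (∃ CB : ℝ, ∀ (j : ℕ) (X : (Sect2.domSys (F.P p.K) θ.τ9.M j).Dom) (U : GaugeField (F.P p.K) 0 (SU N)) (a : Tk.SFluct (F.P p.K) (FluctV N)),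
            |((t s.init).B j X (Sect2.ofBackgroundC (settingOfRecord₁₃ F N θ.toStage13Params p).ι U) a).re| ≤ CB))
    (hsup : Sect3SpliceSupplyAt θ p k) (hS : SLaw₁₃CoPH F N θ p k) : TLaw₁₃CoPH F N θ p k :=
  tLaw₁₃CoPH_of_sLaw₁₃CoPH_of_tStep_of_supply θ p hM hB₀ hE₀ hS (noExpansionTStepAt_of_jointCoercive_termRows_at_present_parents θ p h hU hk hM hrows)
    (sect3SupplyAt_of_spliceSupply θ p hE₀ hB₀ hsup)

/-- **★★ THE (S1ᵀ) SLOT `∀ k < K, SLaw₁₃CoPH θ p k → TLaw₁₃CoPH θ p k` AT A GENERIC `θ` — the ROW SHAPE `h11` of the K1⁷ four-pin engine — FROM (per level) THE JOINT-SUPPORT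
COERCIVE TERM-ROW LIST AND THE SPLICE SUPPLY** (§1 at each level). [cite: Balaban1988Convergent, Theorem p.245, Thm 1 p.262, §2 p.262, (3.24)–(3.25) p.270, p.279; Balaban1987RG1, (2.11) p.267 (shape)] -/
theorem thmP245Laws_of_jointCoercive_termRows_of_spliceSupply (h : θ.Provisos₁₃CoPH F N) (hU : θ.ZhUnity F N) (hM : 1 ≤ θ.τ9.M) (hB₀ : 0 ≤ θ.s2.lf.B₀) (hE₀ : 0 ≤ θ.s2.lf.E₀)
    (hrows : ∀ k, k < p.K → ∀ (t : SeqOfRecord F θ.ν θ.τ9.M (gOfRecord₁₃ F N θ.toStage13Params p) p.K k → Sect2.TermValues (F.P p.K) (MatA N) (FluctV N) θ.τ9.M)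
        (Ek : SeqOfRecord F θ.ν θ.τ9.M (gOfRecord₁₃ F N θ.toStage13Params p) p.K k → ℝ),
        HasSect2FormAtZS F N (FluctV N) p.K (settingOfRecord₁₃ F N θ.toStage13Params p) k (θ.rzAt p) (WtOfRecord₁₃H F N θ p)
          (UbgOfRecord₁₃CoP F N θ.toStage13Params p k)
          (fun s u => Sect2.LawsRT (sect2TowerOfRecord F N (FluctV N) p.K (settingOfRecord₁₃ F N θ.toStage13Params p) (θ.rzAt p s) s u)
            (settingOfRecord₁₃ F N θ.toStage13Params p).lf k)
          (slotsOfRecord F N θ.ν θ.τ9 (EOfRecord₁₃ F N θ.toStage13Params) (wOfRecord₉ F N θ.toStage9Params) θ.ppSel p (gOfRecord₁₃ F N θ.toStage13Params p) k) t Ek →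
        (∀ s₀, IsFluctLocal k (t s₀)) →
        ∀ s : SeqOfRecord F θ.ν θ.τ9.M (gOfRecord₁₃ F N θ.toStage13Params p) p.K (k + 1), s.Ω (k + 1) = ∅ →
          slotsOfRecord F N θ.ν θ.τ9 (EOfRecord₁₃ F N θ.toStage13Params) (wOfRecord₉ F N θ.toStage9Params) θ.ppSel p (gOfRecord₁₃ F N θ.toStage13Params p) k s.init ≠ 0 →
          (∀ j, j < k → (θ.zhAt p s).ζ0 j = (θ.zhAt p s.init).ζ0 j ∧ (θ.zhAt p s).quad j = (θ.zhAt p s.init).quad j) ∧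
          (∀ (V' : GaugeField (F.P p.K) (k + 1) (SU N)) (U₀ : GaugeField (F.P p.K) k (SU N)),
            (θ.zhAt p s).ζ0 k Set.univ (pairCfgAt (V := FluctV N) k V' U₀) =
              chiSeqOfRecord F N θ.ν θ.τ9.M (gOfRecord₁₃ F N θ.toStage13Params p) p.K k s.init U₀ *
                wOfRecord₉ F N θ.toStage9Params p (gOfRecord₁₃ F N θ.toStage13Params p) k s U₀ ((avOfRecord F N p.K k).avg U₀)) ∧
          (∀ (V' : GaugeField (F.P p.K) (k + 1) (SU N)) (U₀ : GaugeField (F.P p.K) k (SU N)), (θ.zhAt p s).quad k ∅ (pairCfgAt (V := FluctV N) k V' U₀) = 0) ∧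
          (∀ j, j < k → ∀ ω ω' : MultiCfg (F.P p.K) (SU N) (FluctV N), (∀ i, i ≤ k → ω i = ω' i) →
            (θ.zhAt p s).quad j (s.init.Λ (j + 1)) ω = (θ.zhAt p s).quad j (s.init.Λ (j + 1)) ω') ∧
          (∀ j (Y : Set (Site (F.P p.K) 0)), Measurable ((θ.zhAt p s).ζ0 j Y)) ∧
          (∀ j (Λ' : Set (Site (F.P p.K) 0)), Measurable ((θ.zhAt p s).quad j Λ')) ∧
          (∀ j : ℕ, j < k → ∃ c : ℝ, 0 < c ∧ ∀ ω' : MultiCfg (F.P p.K) (SU N) (FluctV N),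
            chiSeqOfRecord F N θ.ν θ.τ9.M (gOfRecord₁₃ F N θ.toStage13Params p) p.K k s.init (ω' k).1 ≠ 0 →
            (∀ i, j ≤ i → i < k → ∃ cf : JCfg (F.P p.K) i (SU N) (FluctV N), cf.1 = (ω' i).1 ∧
              (∀ b, b ∉ bondsIn i ((s.init.Λ (i + 1))ᶜ ∩ s.init.Ω (i + 1)) → cf.2 b = (ω' i).2 b) ∧
              (θ.zhAt p s).ζ0 i (s.init.Ω (i + 1))ᶜ (Function.update ω' i cf) ≠ 0) →
            c * ∑ b ∈ (Set.toFinite (bondsIn j ((s.init.Λ (j + 1))ᶜ ∩ s.init.Ω (j + 1)))).toFinset, ‖(ω' j).2 b‖ ^ 2 ≤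
              (θ.zhAt p s).quad j (s.init.Λ (j + 1)) ω') ∧
          (∀ (j : ℕ) (X : (Sect2.domSys (F.P p.K) θ.τ9.M j).Dom) (z : Site (F.P p.K) j) (g' : ℝ),
            Measurable (fun U : GaugeField (F.P p.K) 0 (SU N) => ((t s.init).E j X z g' (Sect2.ofBackgroundC (settingOfRecord₁₃ F N θ.toStage13Params p).ι U)).re)) ∧
          (∀ (j : ℕ) (X : (Sect2.domSys (F.P p.K) θ.τ9.M j).Dom),
            Measurable (fun U : GaugeField (F.P p.K) 0 (SU N) => ((t s.init).R j X (Sect2.ofBackgroundC (settingOfRecord₁₃ F N θ.toStage13Params p).ι U)).re)) ∧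
          (∀ (S' : ℕ → Set (Site (F.P p.K) 0)) (j : ℕ) (X : (Sect2.domSys (F.P p.K) θ.τ9.M j).Dom),
            Measurable (fun q : GaugeField (F.P p.K) 0 (SU N) × MSFluct (F.P p.K) (FluctV N) =>
              ((t s.init).B j X (Sect2.ofBackgroundC (settingOfRecord₁₃ F N θ.toStage13Params p).ι q.1) (S', q.2)).re)) ∧
          (∃ CE : ℝ, ∀ (j : ℕ) (X : (Sect2.domSys (F.P p.K) θ.τ9.M j).Dom) (z : Site (F.P p.K) j) (g' : ℝ) (U : GaugeField (F.P p.K) 0 (SU N)),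
            |((t s.init).E j X z g' (Sect2.ofBackgroundC (settingOfRecord₁₃ F N θ.toStage13Params p).ι U)).re| ≤ CE) ∧
          (∃ CR : ℝ, ∀ (j : ℕ) (X : (Sect2.domSys (F.P p.K) θ.τ9.M j).Dom) (U : GaugeField (F.P p.K) 0 (SU N)),
            |((t s.init).R j X (Sect2.ofBackgroundC (settingOfRecord₁₃ F N θ.toStage13Params p).ι U)).re| ≤ CR) ∧
          (∃ CB : ℝ, ∀ (j : ℕ) (X : (Sect2.domSys (F.P p.K) θ.τ9.M j).Dom) (U : GaugeField (F.P p.K) 0 (SU N)) (a : Tk.SFluct (F.P p.K) (FluctV N)),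
            |((t s.init).B j X (Sect2.ofBackgroundC (settingOfRecord₁₃ F N θ.toStage13Params p).ι U) a).re| ≤ CB))
    (hsup : ∀ k, k < p.K → Sect3SpliceSupplyAt θ p k) :
    ∀ k, k < p.K → SLaw₁₃CoPH F N θ p k → TLaw₁₃CoPH F N θ p k :=
  fun k hk hS => tLaw₁₃CoPH_of_sLaw₁₃CoPH_of_jointCoercive_termRows_of_spliceSupply θ p h hU hk hM hB₀ hE₀ (hrows k hk) (hsup k hk) hS

/-! ## §2  The node faces at a world bound to the CoPH datum of `θ`, and [III] Thm 1 at that datum -/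

/-- **★★ N11's NODE SENTENCE `densitiesDescribed` AT A WORLD BOUND TO THE CoPH DATUM OF `θ`** (`w.C = (datumOfRecord₁₃CoPH θ h).C`) from (per level) the joint-support coercive term-row list
and the splice supply, on the live-selector line — dag-n11-e's `densitiesDescribed_of_tStep_of_supply_of_liveSel` fed by p588421 and p586169.
[cite: Balaban1988Convergent, Thm 1 p.262, Theorem p.245, p.244; Balaban1989LargeFieldI, (0.3) p.176, p.177 (i)–(ii); Balaban1987RG1, (2.11) p.267 (shape)] -/
theorem densitiesDescribed_of_jointCoercive_termRows_of_spliceSupply_of_liveSel (h : θ.Provisos₁₃CoPH F N) (hU : θ.ZhUnity F N)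
    (hsel : θ.ppSel = ppSelLiveOfRecord F N θ.ν θ.τ9 (EOfRecord₁₃ F N θ.toStage13Params) (wOfRecord₉ F N θ.toStage9Params))
    (hθ : θ.Admissible F N) (hκ : 0 ≤ θ.s2.lf.κ) (hE₀ : 0 ≤ θ.s2.lf.E₀) (hB₀ : 0 ≤ θ.s2.lf.B₀) (hM : 1 ≤ θ.τ9.M)
    (hrows : ∀ k, k < p.K → ∀ (t : SeqOfRecord F θ.ν θ.τ9.M (gOfRecord₁₃ F N θ.toStage13Params p) p.K k → Sect2.TermValues (F.P p.K) (MatA N) (FluctV N) θ.τ9.M)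
        (Ek : SeqOfRecord F θ.ν θ.τ9.M (gOfRecord₁₃ F N θ.toStage13Params p) p.K k → ℝ),
        HasSect2FormAtZS F N (FluctV N) p.K (settingOfRecord₁₃ F N θ.toStage13Params p) k (θ.rzAt p) (WtOfRecord₁₃H F N θ p)
          (UbgOfRecord₁₃CoP F N θ.toStage13Params p k)
          (fun s u => Sect2.LawsRT (sect2TowerOfRecord F N (FluctV N) p.K (settingOfRecord₁₃ F N θ.toStage13Params p) (θ.rzAt p s) s u)
            (settingOfRecord₁₃ F N θ.toStage13Params p).lf k)
          (slotsOfRecord F N θ.ν θ.τ9 (EOfRecord₁₃ F N θ.toStage13Params) (wOfRecord₉ F N θ.toStage9Params) θ.ppSel p (gOfRecord₁₃ F N θ.toStage13Params p) k) t Ek →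
        (∀ s₀, IsFluctLocal k (t s₀)) →
        ∀ s : SeqOfRecord F θ.ν θ.τ9.M (gOfRecord₁₃ F N θ.toStage13Params p) p.K (k + 1), s.Ω (k + 1) = ∅ →
          slotsOfRecord F N θ.ν θ.τ9 (EOfRecord₁₃ F N θ.toStage13Params) (wOfRecord₉ F N θ.toStage9Params) θ.ppSel p (gOfRecord₁₃ F N θ.toStage13Params p) k s.init ≠ 0 →
          (∀ j, j < k → (θ.zhAt p s).ζ0 j = (θ.zhAt p s.init).ζ0 j ∧ (θ.zhAt p s).quad j = (θ.zhAt p s.init).quad j) ∧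
          (∀ (V' : GaugeField (F.P p.K) (k + 1) (SU N)) (U₀ : GaugeField (F.P p.K) k (SU N)),
            (θ.zhAt p s).ζ0 k Set.univ (pairCfgAt (V := FluctV N) k V' U₀) =
              chiSeqOfRecord F N θ.ν θ.τ9.M (gOfRecord₁₃ F N θ.toStage13Params p) p.K k s.init U₀ *
                wOfRecord₉ F N θ.toStage9Params p (gOfRecord₁₃ F N θ.toStage13Params p) k s U₀ ((avOfRecord F N p.K k).avg U₀)) ∧
          (∀ (V' : GaugeField (F.P p.K) (k + 1) (SU N)) (U₀ : GaugeField (F.P p.K) k (SU N)), (θ.zhAt p s).quad k ∅ (pairCfgAt (V := FluctV N) k V' U₀) = 0) ∧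
          (∀ j, j < k → ∀ ω ω' : MultiCfg (F.P p.K) (SU N) (FluctV N), (∀ i, i ≤ k → ω i = ω' i) →
            (θ.zhAt p s).quad j (s.init.Λ (j + 1)) ω = (θ.zhAt p s).quad j (s.init.Λ (j + 1)) ω') ∧
          (∀ j (Y : Set (Site (F.P p.K) 0)), Measurable ((θ.zhAt p s).ζ0 j Y)) ∧
          (∀ j (Λ' : Set (Site (F.P p.K) 0)), Measurable ((θ.zhAt p s).quad j Λ')) ∧
          (∀ j : ℕ, j < k → ∃ c : ℝ, 0 < c ∧ ∀ ω' : MultiCfg (F.P p.K) (SU N) (FluctV N),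
            chiSeqOfRecord F N θ.ν θ.τ9.M (gOfRecord₁₃ F N θ.toStage13Params p) p.K k s.init (ω' k).1 ≠ 0 →
            (∀ i, j ≤ i → i < k → ∃ cf : JCfg (F.P p.K) i (SU N) (FluctV N), cf.1 = (ω' i).1 ∧
              (∀ b, b ∉ bondsIn i ((s.init.Λ (i + 1))ᶜ ∩ s.init.Ω (i + 1)) → cf.2 b = (ω' i).2 b) ∧
              (θ.zhAt p s).ζ0 i (s.init.Ω (i + 1))ᶜ (Function.update ω' i cf) ≠ 0) →
            c * ∑ b ∈ (Set.toFinite (bondsIn j ((s.init.Λ (j + 1))ᶜ ∩ s.init.Ω (j + 1)))).toFinset, ‖(ω' j).2 b‖ ^ 2 ≤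
              (θ.zhAt p s).quad j (s.init.Λ (j + 1)) ω') ∧
          (∀ (j : ℕ) (X : (Sect2.domSys (F.P p.K) θ.τ9.M j).Dom) (z : Site (F.P p.K) j) (g' : ℝ),
            Measurable (fun U : GaugeField (F.P p.K) 0 (SU N) => ((t s.init).E j X z g' (Sect2.ofBackgroundC (settingOfRecord₁₃ F N θ.toStage13Params p).ι U)).re)) ∧
          (∀ (j : ℕ) (X : (Sect2.domSys (F.P p.K) θ.τ9.M j).Dom),
            Measurable (fun U : GaugeField (F.P p.K) 0 (SU N) => ((t s.init).R j X (Sect2.ofBackgroundC (settingOfRecord₁₃ F N θ.toStage13Params p).ι U)).re)) ∧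
          (∀ (S' : ℕ → Set (Site (F.P p.K) 0)) (j : ℕ) (X : (Sect2.domSys (F.P p.K) θ.τ9.M j).Dom),
            Measurable (fun q : GaugeField (F.P p.K) 0 (SU N) × MSFluct (F.P p.K) (FluctV N) =>
              ((t s.init).B j X (Sect2.ofBackgroundC (settingOfRecord₁₃ F N θ.toStage13Params p).ι q.1) (S', q.2)).re)) ∧
          (∃ CE : ℝ, ∀ (j : ℕ) (X : (Sect2.domSys (F.P p.K) θ.τ9.M j).Dom) (z : Site (F.P p.K) j) (g' : ℝ) (U : GaugeField (F.P p.K) 0 (SU N)),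
            |((t s.init).E j X z g' (Sect2.ofBackgroundC (settingOfRecord₁₃ F N θ.toStage13Params p).ι U)).re| ≤ CE) ∧
          (∃ CR : ℝ, ∀ (j : ℕ) (X : (Sect2.domSys (F.P p.K) θ.τ9.M j).Dom) (U : GaugeField (F.P p.K) 0 (SU N)),
            |((t s.init).R j X (Sect2.ofBackgroundC (settingOfRecord₁₃ F N θ.toStage13Params p).ι U)).re| ≤ CR) ∧
          (∃ CB : ℝ, ∀ (j : ℕ) (X : (Sect2.domSys (F.P p.K) θ.τ9.M j).Dom) (U : GaugeField (F.P p.K) 0 (SU N)) (a : Tk.SFluct (F.P p.K) (FluctV N)),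
            |((t s.init).B j X (Sect2.ofBackgroundC (settingOfRecord₁₃ F N θ.toStage13Params p).ι U) a).re| ≤ CB))
    (hsup : ∀ k, k < p.K → Sect3SpliceSupplyAt θ p k)
    (w : WorldP) (hC : w.C = (datumOfRecord₁₃CoPH F N θ h).C) :
    (leavesP w p).densitiesDescribed :=
  densitiesDescribed_of_tStep_of_supply_of_liveSel θ p h hsel hθ hκ hE₀ hB₀ hM
    (fun k hk => noExpansionTStepAt_of_jointCoercive_termRows_at_present_parents θ p h hU hk hM (hrows k hk))
    (fun k hk => sect3SupplyAt_of_spliceSupply θ p hE₀ hB₀ (hsup k hk)) w hC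

/-- **★★★ N11's DAG NODE `Dag.B14_main (leavesP w p)` AT A WORLD BOUND TO THE CoPH DATUM OF `θ`** from (per level) the joint-support coercive term-row list and the splice supply, on the
live-selector line — dag-n11-e's `b14_main_of_tStep_of_supply_of_liveSel` (the 𝐑-antecedent read through the leaf at the carriers of record) fed by p588421 and p586169: the
node from node00-def-K0b's VALUE rows (incl. JOINT-SUPPORT COERCIVITY of `quad`), node00-def-T's six term rows and the §3 supplier's `Sect3SpliceSupplyAt`, nothing else.
[cite: Balaban1988Convergent, Thm 1 p.262, Theorem p.245, p.244; Balaban1989LargeFieldI, (0.3) p.176, p.177 (i)–(ii); Balaban1987RG1, (2.11) p.267 (shape)] -/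
theorem b14_main_of_jointCoercive_termRows_of_spliceSupply_of_liveSel (h : θ.Provisos₁₃CoPH F N) (hU : θ.ZhUnity F N)
    (hsel : θ.ppSel = ppSelLiveOfRecord F N θ.ν θ.τ9 (EOfRecord₁₃ F N θ.toStage13Params) (wOfRecord₉ F N θ.toStage9Params))
    (hθ : θ.Admissible F N) (hκ : 0 ≤ θ.s2.lf.κ) (hE₀ : 0 ≤ θ.s2.lf.E₀) (hB₀ : 0 ≤ θ.s2.lf.B₀) (hM : 1 ≤ θ.τ9.M)
    (hrows : ∀ k, k < p.K → ∀ (t : SeqOfRecord F θ.ν θ.τ9.M (gOfRecord₁₃ F N θ.toStage13Params p) p.K k → Sect2.TermValues (F.P p.K) (MatA N) (FluctV N) θ.τ9.M)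
        (Ek : SeqOfRecord F θ.ν θ.τ9.M (gOfRecord₁₃ F N θ.toStage13Params p) p.K k → ℝ),
        HasSect2FormAtZS F N (FluctV N) p.K (settingOfRecord₁₃ F N θ.toStage13Params p) k (θ.rzAt p) (WtOfRecord₁₃H F N θ p)
          (UbgOfRecord₁₃CoP F N θ.toStage13Params p k)
          (fun s u => Sect2.LawsRT (sect2TowerOfRecord F N (FluctV N) p.K (settingOfRecord₁₃ F N θ.toStage13Params p) (θ.rzAt p s) s u)
            (settingOfRecord₁₃ F N θ.toStage13Params p).lf k)
          (slotsOfRecord F N θ.ν θ.τ9 (EOfRecord₁₃ F N θ.toStage13Params) (wOfRecord₉ F N θ.toStage9Params) θ.ppSel p (gOfRecord₁₃ F N θ.toStage13Params p) k) t Ek →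
        (∀ s₀, IsFluctLocal k (t s₀)) →
        ∀ s : SeqOfRecord F θ.ν θ.τ9.M (gOfRecord₁₃ F N θ.toStage13Params p) p.K (k + 1), s.Ω (k + 1) = ∅ →
          slotsOfRecord F N θ.ν θ.τ9 (EOfRecord₁₃ F N θ.toStage13Params) (wOfRecord₉ F N θ.toStage9Params) θ.ppSel p (gOfRecord₁₃ F N θ.toStage13Params p) k s.init ≠ 0 →
          (∀ j, j < k → (θ.zhAt p s).ζ0 j = (θ.zhAt p s.init).ζ0 j ∧ (θ.zhAt p s).quad j = (θ.zhAt p s.init).quad j) ∧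
          (∀ (V' : GaugeField (F.P p.K) (k + 1) (SU N)) (U₀ : GaugeField (F.P p.K) k (SU N)),
            (θ.zhAt p s).ζ0 k Set.univ (pairCfgAt (V := FluctV N) k V' U₀) =
              chiSeqOfRecord F N θ.ν θ.τ9.M (gOfRecord₁₃ F N θ.toStage13Params p) p.K k s.init U₀ *
                wOfRecord₉ F N θ.toStage9Params p (gOfRecord₁₃ F N θ.toStage13Params p) k s U₀ ((avOfRecord F N p.K k).avg U₀)) ∧
          (∀ (V' : GaugeField (F.P p.K) (k + 1) (SU N)) (U₀ : GaugeField (F.P p.K) k (SU N)), (θ.zhAt p s).quad k ∅ (pairCfgAt (V := FluctV N) k V' U₀) = 0) ∧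
          (∀ j, j < k → ∀ ω ω' : MultiCfg (F.P p.K) (SU N) (FluctV N), (∀ i, i ≤ k → ω i = ω' i) →
            (θ.zhAt p s).quad j (s.init.Λ (j + 1)) ω = (θ.zhAt p s).quad j (s.init.Λ (j + 1)) ω') ∧
          (∀ j (Y : Set (Site (F.P p.K) 0)), Measurable ((θ.zhAt p s).ζ0 j Y)) ∧
          (∀ j (Λ' : Set (Site (F.P p.K) 0)), Measurable ((θ.zhAt p s).quad j Λ')) ∧
          (∀ j : ℕ, j < k → ∃ c : ℝ, 0 < c ∧ ∀ ω' : MultiCfg (F.P p.K) (SU N) (FluctV N),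
            chiSeqOfRecord F N θ.ν θ.τ9.M (gOfRecord₁₃ F N θ.toStage13Params p) p.K k s.init (ω' k).1 ≠ 0 →
            (∀ i, j ≤ i → i < k → ∃ cf : JCfg (F.P p.K) i (SU N) (FluctV N), cf.1 = (ω' i).1 ∧
              (∀ b, b ∉ bondsIn i ((s.init.Λ (i + 1))ᶜ ∩ s.init.Ω (i + 1)) → cf.2 b = (ω' i).2 b) ∧
              (θ.zhAt p s).ζ0 i (s.init.Ω (i + 1))ᶜ (Function.update ω' i cf) ≠ 0) →
            c * ∑ b ∈ (Set.toFinite (bondsIn j ((s.init.Λ (j + 1))ᶜ ∩ s.init.Ω (j + 1)))).toFinset, ‖(ω' j).2 b‖ ^ 2 ≤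
              (θ.zhAt p s).quad j (s.init.Λ (j + 1)) ω') ∧
          (∀ (j : ℕ) (X : (Sect2.domSys (F.P p.K) θ.τ9.M j).Dom) (z : Site (F.P p.K) j) (g' : ℝ),
            Measurable (fun U : GaugeField (F.P p.K) 0 (SU N) => ((t s.init).E j X z g' (Sect2.ofBackgroundC (settingOfRecord₁₃ F N θ.toStage13Params p).ι U)).re)) ∧
          (∀ (j : ℕ) (X : (Sect2.domSys (F.P p.K) θ.τ9.M j).Dom),
            Measurable (fun U : GaugeField (F.P p.K) 0 (SU N) => ((t s.init).R j X (Sect2.ofBackgroundC (settingOfRecord₁₃ F N θ.toStage13Params p).ι U)).re)) ∧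
          (∀ (S' : ℕ → Set (Site (F.P p.K) 0)) (j : ℕ) (X : (Sect2.domSys (F.P p.K) θ.τ9.M j).Dom),
            Measurable (fun q : GaugeField (F.P p.K) 0 (SU N) × MSFluct (F.P p.K) (FluctV N) =>
              ((t s.init).B j X (Sect2.ofBackgroundC (settingOfRecord₁₃ F N θ.toStage13Params p).ι q.1) (S', q.2)).re)) ∧
          (∃ CE : ℝ, ∀ (j : ℕ) (X : (Sect2.domSys (F.P p.K) θ.τ9.M j).Dom) (z : Site (F.P p.K) j) (g' : ℝ) (U : GaugeField (F.P p.K) 0 (SU N)),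
            |((t s.init).E j X z g' (Sect2.ofBackgroundC (settingOfRecord₁₃ F N θ.toStage13Params p).ι U)).re| ≤ CE) ∧
          (∃ CR : ℝ, ∀ (j : ℕ) (X : (Sect2.domSys (F.P p.K) θ.τ9.M j).Dom) (U : GaugeField (F.P p.K) 0 (SU N)),
            |((t s.init).R j X (Sect2.ofBackgroundC (settingOfRecord₁₃ F N θ.toStage13Params p).ι U)).re| ≤ CR) ∧
          (∃ CB : ℝ, ∀ (j : ℕ) (X : (Sect2.domSys (F.P p.K) θ.τ9.M j).Dom) (U : GaugeField (F.P p.K) 0 (SU N)) (a : Tk.SFluct (F.P p.K) (FluctV N)),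
            |((t s.init).B j X (Sect2.ofBackgroundC (settingOfRecord₁₃ F N θ.toStage13Params p).ι U) a).re| ≤ CB))
    (hsup : ∀ k, k < p.K → Sect3SpliceSupplyAt θ p k)
    (w : WorldP) (hC : w.C = (datumOfRecord₁₃CoPH F N θ h).C) :
    Dag.B14_main (leavesP w p) :=
  b14_main_of_tStep_of_supply_of_liveSel θ p h hsel hθ hκ hE₀ hB₀ hM
    (fun k hk => noExpansionTStepAt_of_jointCoercive_termRows_at_present_parents θ p h hU hk hM (hrows k hk))
    (fun k hk => sect3SupplyAt_of_spliceSupply θ p hE₀ hB₀ (hsup k hk)) w hC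

/-- **★★★ `B16.Thm1Printed (datumOfRecord₁₃CoPH F N θ h).C` — [III] THEOREM 1 AT THE CoPH DATUM OF A GENERIC `θ` ALONG EVERY WINDOWED RUN** from (per windowed run and
level) the coercive term-row list and the splice supply, on the live-selector line — dag-n11-e's `thm1Printed_datumOfRecord₁₃CoPH_of_tStep_of_supply_of_liveSel` fed by
p588421 and p586169. [cite: Balaban1988Convergent, Thm 1 p.262, Theorem p.245, p.244; Balaban1989LargeFieldI, (0.3) p.176, p.177 (i)–(ii); Balaban1987RG1, (2.11) p.267 (shape)] -/
theorem thm1Printed_datumOfRecord₁₃CoPH_of_jointCoercive_termRows_of_spliceSupply_of_liveSel (h : θ.Provisos₁₃CoPH F N) (hU : θ.ZhUnity F N)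
    (hsel : θ.ppSel = ppSelLiveOfRecord F N θ.ν θ.τ9 (EOfRecord₁₃ F N θ.toStage13Params) (wOfRecord₉ F N θ.toStage9Params))
    (hθ : θ.Admissible F N) (hκ : 0 ≤ θ.s2.lf.κ) (hE₀ : 0 ≤ θ.s2.lf.E₀) (hB₀ : 0 ≤ θ.s2.lf.B₀) (hM : 1 ≤ θ.τ9.M) {γ : ℝ} (hγ : 0 < γ)
    (hrows : ∀ P : B12.RunParams, ((datumOfRecord₁₃CoPH F N θ h).C P).flow.InInterval γ P.K → ∀ k, k < P.K → ∀ (t : SeqOfRecord F θ.ν θ.τ9.M (gOfRecord₁₃ F N θ.toStage13Params P) P.K k → Sect2.TermValues (F.P P.K) (MatA N) (FluctV N) θ.τ9.M)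
        (Ek : SeqOfRecord F θ.ν θ.τ9.M (gOfRecord₁₃ F N θ.toStage13Params P) P.K k → ℝ),
        HasSect2FormAtZS F N (FluctV N) P.K (settingOfRecord₁₃ F N θ.toStage13Params P) k (θ.rzAt P) (WtOfRecord₁₃H F N θ P)
          (UbgOfRecord₁₃CoP F N θ.toStage13Params P k)
          (fun s u => Sect2.LawsRT (sect2TowerOfRecord F N (FluctV N) P.K (settingOfRecord₁₃ F N θ.toStage13Params P) (θ.rzAt P s) s u)
            (settingOfRecord₁₃ F N θ.toStage13Params P).lf k)
          (slotsOfRecord F N θ.ν θ.τ9 (EOfRecord₁₃ F N θ.toStage13Params) (wOfRecord₉ F N θ.toStage9Params) θ.ppSel P (gOfRecord₁₃ F N θ.toStage13Params P) k) t Ek →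
        (∀ s₀, IsFluctLocal k (t s₀)) →
        ∀ s : SeqOfRecord F θ.ν θ.τ9.M (gOfRecord₁₃ F N θ.toStage13Params P) P.K (k + 1), s.Ω (k + 1) = ∅ →
          slotsOfRecord F N θ.ν θ.τ9 (EOfRecord₁₃ F N θ.toStage13Params) (wOfRecord₉ F N θ.toStage9Params) θ.ppSel P (gOfRecord₁₃ F N θ.toStage13Params P) k s.init ≠ 0 →
          (∀ j, j < k → (θ.zhAt P s).ζ0 j = (θ.zhAt P s.init).ζ0 j ∧ (θ.zhAt P s).quad j = (θ.zhAt P s.init).quad j) ∧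
          (∀ (V' : GaugeField (F.P P.K) (k + 1) (SU N)) (U₀ : GaugeField (F.P P.K) k (SU N)),
            (θ.zhAt P s).ζ0 k Set.univ (pairCfgAt (V := FluctV N) k V' U₀) =
              chiSeqOfRecord F N θ.ν θ.τ9.M (gOfRecord₁₃ F N θ.toStage13Params P) P.K k s.init U₀ *
                wOfRecord₉ F N θ.toStage9Params P (gOfRecord₁₃ F N θ.toStage13Params P) k s U₀ ((avOfRecord F N P.K k).avg U₀)) ∧
          (∀ (V' : GaugeField (F.P P.K) (k + 1) (SU N)) (U₀ : GaugeField (F.P P.K) k (SU N)), (θ.zhAt P s).quad k ∅ (pairCfgAt (V := FluctV N) k V' U₀) = 0) ∧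
          (∀ j, j < k → ∀ ω ω' : MultiCfg (F.P P.K) (SU N) (FluctV N), (∀ i, i ≤ k → ω i = ω' i) →
            (θ.zhAt P s).quad j (s.init.Λ (j + 1)) ω = (θ.zhAt P s).quad j (s.init.Λ (j + 1)) ω') ∧
          (∀ j (Y : Set (Site (F.P P.K) 0)), Measurable ((θ.zhAt P s).ζ0 j Y)) ∧
          (∀ j (Λ' : Set (Site (F.P P.K) 0)), Measurable ((θ.zhAt P s).quad j Λ')) ∧
          (∀ j : ℕ, j < k → ∃ c : ℝ, 0 < c ∧ ∀ ω' : MultiCfg (F.P P.K) (SU N) (FluctV N),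
            chiSeqOfRecord F N θ.ν θ.τ9.M (gOfRecord₁₃ F N θ.toStage13Params P) P.K k s.init (ω' k).1 ≠ 0 →
            (∀ i, j ≤ i → i < k → ∃ cf : JCfg (F.P P.K) i (SU N) (FluctV N), cf.1 = (ω' i).1 ∧
              (∀ b, b ∉ bondsIn i ((s.init.Λ (i + 1))ᶜ ∩ s.init.Ω (i + 1)) → cf.2 b = (ω' i).2 b) ∧
              (θ.zhAt P s).ζ0 i (s.init.Ω (i + 1))ᶜ (Function.update ω' i cf) ≠ 0) →
            c * ∑ b ∈ (Set.toFinite (bondsIn j ((s.init.Λ (j + 1))ᶜ ∩ s.init.Ω (j + 1)))).toFinset, ‖(ω' j).2 b‖ ^ 2 ≤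
              (θ.zhAt P s).quad j (s.init.Λ (j + 1)) ω') ∧
          (∀ (j : ℕ) (X : (Sect2.domSys (F.P P.K) θ.τ9.M j).Dom) (z : Site (F.P P.K) j) (g' : ℝ),
            Measurable (fun U : GaugeField (F.P P.K) 0 (SU N) => ((t s.init).E j X z g' (Sect2.ofBackgroundC (settingOfRecord₁₃ F N θ.toStage13Params P).ι U)).re)) ∧
          (∀ (j : ℕ) (X : (Sect2.domSys (F.P P.K) θ.τ9.M j).Dom),
            Measurable (fun U : GaugeField (F.P P.K) 0 (SU N) => ((t s.init).R j X (Sect2.ofBackgroundC (settingOfRecord₁₃ F N θ.toStage13Params P).ι U)).re)) ∧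
          (∀ (S' : ℕ → Set (Site (F.P P.K) 0)) (j : ℕ) (X : (Sect2.domSys (F.P P.K) θ.τ9.M j).Dom),
            Measurable (fun q : GaugeField (F.P P.K) 0 (SU N) × MSFluct (F.P P.K) (FluctV N) =>
              ((t s.init).B j X (Sect2.ofBackgroundC (settingOfRecord₁₃ F N θ.toStage13Params P).ι q.1) (S', q.2)).re)) ∧
          (∃ CE : ℝ, ∀ (j : ℕ) (X : (Sect2.domSys (F.P P.K) θ.τ9.M j).Dom) (z : Site (F.P P.K) j) (g' : ℝ) (U : GaugeField (F.P P.K) 0 (SU N)),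
            |((t s.init).E j X z g' (Sect2.ofBackgroundC (settingOfRecord₁₃ F N θ.toStage13Params P).ι U)).re| ≤ CE) ∧
          (∃ CR : ℝ, ∀ (j : ℕ) (X : (Sect2.domSys (F.P P.K) θ.τ9.M j).Dom) (U : GaugeField (F.P P.K) 0 (SU N)),
            |((t s.init).R j X (Sect2.ofBackgroundC (settingOfRecord₁₃ F N θ.toStage13Params P).ι U)).re| ≤ CR) ∧
          (∃ CB : ℝ, ∀ (j : ℕ) (X : (Sect2.domSys (F.P P.K) θ.τ9.M j).Dom) (U : GaugeField (F.P P.K) 0 (SU N)) (a : Tk.SFluct (F.P P.K) (FluctV N)),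
            |((t s.init).B j X (Sect2.ofBackgroundC (settingOfRecord₁₃ F N θ.toStage13Params P).ι U) a).re| ≤ CB))
    (hsup : ∀ P : B12.RunParams, ((datumOfRecord₁₃CoPH F N θ h).C P).flow.InInterval γ P.K → ∀ k, k < P.K → Sect3SpliceSupplyAt θ P k) :
    B16.Thm1Printed (datumOfRecord₁₃CoPH F N θ h).C :=
  thm1Printed_datumOfRecord₁₃CoPH_of_tStep_of_supply_of_liveSel θ h hsel hθ hκ hE₀ hB₀ hM hγ
    (fun P hP k hk => noExpansionTStepAt_of_jointCoercive_termRows_at_present_parents θ P h hU hk hM (hrows P hP k hk))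
    (fun P hP k hk => sect3SupplyAt_of_spliceSupply θ P hE₀ hB₀ (hsup P hP k hk))

end Summit.QuantumFields.YangMills.Theorems.BalabanUVNodesN11NodeFacesOfCoerciveOnJointSupport

end
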